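import Summits.ResolutionOfSingularities.ResolutionOfSingularities.Theorems.HomologicalConductorPersistenceSurfaceCompletedStepLevelFree
import HarnessLib

/-!
# Rung S-2 `PersistenceSurface` (stmt-ResolutionOfSingularities-19970): the level-free-target stubs are NECESSARY —
# converse doors (fact-free) and the calibration `PersistenceSurface ↔ LevelFourPersistenceSurface'` modulo Sat₄

Route `ResolutionOfSingularities/HomologicalConductor`, chain W4.4b, rung S-2.  OURS (hand leafhand-res-homologicalconduct-20 g2,
2026-08-31); AI-written, weaker than expert review; NOT a statement of the manuscript under study (Hironaka 2017), and no
statement of that manuscript is used.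

The registered skeleton 1a77c002 of the rung closes `PersistenceSurface` from `SaturationFourSurfaceResidual₄` (Sat₄ at the
two-dimensional singular stages with singular successor), `CompletedStepPersistenceRationalNormal'` (CSP‴) and
`LevelFourPersistenceNonnormalOrNonrational'` (L-other′) through the doors of `…CompletedStepLevelFree` /
`…SaturationResidualFour`.  This file records the cheap CONVERSES, all FACT-FREE, which the tree did not state:
since `ca⁴(T) ⊆ ca(T)` for every stage (an element killing all `Ext^i`, `i ≥ 4`, kills all `Ext^i`, `i ≥ n`, for `n = 4`),

* `levelFourPersistenceSurface'_of_persistenceSurface` — `PersistenceSurface → LevelFourPersistenceSurface'`;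
* `levelFourPersistenceRationalNormal'_of_persistenceSurface`, `levelFourPersistenceNonnormalOrNonrational'_of_persistenceSurface`
  — the crux implies BOTH class-restricted level-free-target statements; in particular the registered stub
  `LevelFourPersistenceNonnormalOrNonrational'` is a NECESSARY condition for the rung (a refutation of it refutes
  `PersistenceSurface` — the reading of the ERRATUM in `…SaturationResidualFour`, now a theorem);
* `persistenceSurface_iff_levelFour'_of_saturationFour` — modulo o3's `SaturationFourSurface` (Sat₄ at every stage) the
  rung is EQUIVALENT to `LevelFourPersistenceSurface'`;
* `persistenceSurface_iff_rationalNormal'_and_rest'_of_saturationFour` — and to the conjunction of the two class statements.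

Reading for the planner (repair census of 19970): of the three active conjecture-stubs, L-other′ (stub 4) and the (R♮)
level-free statement are IMPLIED by the crux; only Sat₄ (stub 2) and the completion form CSP‴ (stub 3, whose converse would
need the ASCENT `ca(T) ⊆ ca(T̂)`, not in the tree) carry content beyond a reformulation.  No new definitions, no named-fact
hypotheses.  No crux, stub or summit statement is proved here; resolution of singularities in positive characteristic is NOT
proved.

References: S. B. Iyengar, R. Takahashi, IMRN 2016, Def. 2.1 (`caⁿ ⊆ ca`) [`IyengarTakahashi2014`] — used only through the
inline definitions of the route.
-/

noncomputable section

-- single-problem summit: the doubled namespace component `ResolutionOfSingularities` is forced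
set_option linter.dupNamespace false

namespace Summit.ResolutionOfSingularities.ResolutionOfSingularities.Theorems.HomologicalConductor.PersistenceSurfaceCompletedStepLevelFree

open Summit.ResolutionOfSingularities.ResolutionOfSingularities.Theses.HomologicalConductor (PersistenceSurface)
open Summit.ResolutionOfSingularities.ResolutionOfSingularities.Theorems.HomologicalConductor.PersistenceSurfaceLevelFour

/-! ## The crux implies the level-free-target statements (fact-free) -/

/-- **`PersistenceSurface → LevelFourPersistenceSurface'`**: `ca⁴(T_m) ⊆ ca(T_m) ⊆ ca(T_(m+1))` — an element killing all
`Ext^i`, `i ≥ 4`, kills all `Ext^i`, `i ≥ n`, with `n = 4`.  Fact-free. [cite: IyengarTakahashi2014, Definition 2.1] -/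
theorem levelFourPersistenceSurface'_of_persistenceSurface (h : PersistenceSurface) :
    LevelFourPersistenceSurface' := by
  intro p hp k K _ _ _ _ O A hk hA hfr hAO hdim caAt ca loc chart nrm tower m x hx
  obtain ⟨hx', h4⟩ := hx
  exact h p hp k K O A hk hA hfr hAO hdim m ⟨hx', 4, h4⟩

/-- **`PersistenceSurface → LevelFourPersistenceRationalNormal'`** (the class hypothesis (R♮) is not used).  Fact-free.
[cite: IyengarTakahashi2014, Definition 2.1] -/
theorem levelFourPersistenceRationalNormal'_of_persistenceSurface (h : PersistenceSurface) :
    LevelFourPersistenceRationalNormal' := by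
  intro p hp k K _ _ _ _ O A hk hA hfr hAO hdim caAt ca loc chart nrm tower _ m x hx
  obtain ⟨hx', h4⟩ := hx
  exact h p hp k K O A hk hA hfr hAO hdim m ⟨hx', 4, h4⟩

/-- **`PersistenceSurface → LevelFourPersistenceNonnormalOrNonrational'`** — the registered stub L-other′ of skeleton
1a77c002 is a NECESSARY condition for the rung (the class hypothesis is not used).  Fact-free.
[cite: IyengarTakahashi2014, Definition 2.1] -/
theorem levelFourPersistenceNonnormalOrNonrational'_of_persistenceSurface (h : PersistenceSurface) :
    LevelFourPersistenceNonnormalOrNonrational' := by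
  intro p hp k K _ _ _ _ O A hk hA hfr hAO hdim caAt ca loc chart nrm tower _ m x hx
  obtain ⟨hx', h4⟩ := hx
  exact h p hp k K O A hk hA hfr hAO hdim m ⟨hx', 4, h4⟩

/-! ## Calibration modulo Sat₄ -/

/-- **Modulo o3's `SaturationFourSurface`, the rung is EQUIVALENT to `LevelFourPersistenceSurface'`**
(⇒ fact-free; ⇐ `persistenceSurface_of_saturationFour_of_levelFour'`). [this work] -/
theorem persistenceSurface_iff_levelFour'_of_saturationFour (hS : SaturationFourSurface) :
    PersistenceSurface ↔ LevelFourPersistenceSurface' :=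
  ⟨levelFourPersistenceSurface'_of_persistenceSurface, persistenceSurface_of_saturationFour_of_levelFour' hS⟩

/-- **Modulo `SaturationFourSurface`, the rung is EQUIVALENT to the conjunction of the two class-restricted level-free
statements** (R♮)′ ∧ L-other′ (⇐ by the excluded-middle glue `levelFourPersistenceSurface'_of_rationalNormal'_of_rest'`).
[this work] -/
theorem persistenceSurface_iff_rationalNormal'_and_rest'_of_saturationFour (hS : SaturationFourSurface) :
    PersistenceSurface ↔ (LevelFourPersistenceRationalNormal' ∧ LevelFourPersistenceNonnormalOrNonrational') :=
  ⟨fun h => ⟨levelFourPersistenceRationalNormal'_of_persistenceSurface h,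
      levelFourPersistenceNonnormalOrNonrational'_of_persistenceSurface h⟩,
    fun h => persistenceSurface_of_saturationFour_of_levelFour' hS
      (levelFourPersistenceSurface'_of_rationalNormal'_of_rest' h.1 h.2)⟩

end Summit.ResolutionOfSingularities.ResolutionOfSingularities.Theorems.HomologicalConductor.PersistenceSurfaceCompletedStepLevelFree

end
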